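/-
Copyright: the b2b-balaban T⁴-continuum CRUX team, row NE7b, leaf prover `t4-ne7b-formalise-leaf-01` (gen 80): the port of its
`TiltedMeanShiftInterpolated` ∕ `TiltedMeanShiftEndpoints` to the convex window of the OWNER lineage `t4-ne7b-p1` (gen 107)'s
`ConvexWindowTiltedMeanShift`; the refuter (gen 71)'s σ-ne7bref-g71-1. Project licence.
-/
import Summits.QuantumFields.BalabanUV.T4Continuum.Spine.NE7b.TiltedMeanShiftInterpolated
import Summits.QuantumFields.BalabanUV.T4Continuum.Spine.NE7b.ConvexWindowTiltedMeanShift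

/-!
# THE INTERPOLATED WINDOWED PORT: the derivative-free interpolation END of the tilted-mean shift ON A CONVEX WINDOW `K` —
# `|m_{W+P,K} − m_{W,K}| ≤ λ⁻¹·((a₀∕2)‖u‖² + G∕(2a₀))`, `G = sup_{t∈[0,1]} ∫‖∇P‖² dν_{W+tP,K}`, NO `e^{∫P}` — by TELESCOPING the
# OWNER's windowed one-step theorem (row NE7b, node U5c; model level; the refuter's σ-ne7bref-g71-1 «interpolated windowed port WANTED»)

Cell `pub-balaban`, sub-cell `t4`, spine estimate NE7b (`T4WeightBudget.RelWeightBound` — the cell's OWN estimate, NOT PRINTED in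
[Bałaban 1983–89], NOT PROVED).  Crux-route MODEL work under `Spine/NE7b/`; no `T4Continuum/Support` leaf, no `def`, no `Prop` minted,
nothing of Bałaban's named or asserted; 0 `sorry`.

WHY.  The OWNER's `…NE7b.ConvexWindowTiltedMeanShift.abs_windowTiltedMean_shift_le` ((15), T-60e ON A CONVEX WINDOW `K`, windowed
Brascamp–Lieb from `…ConvexWindowBrascampLieb`) is in ENDPOINT form: its END keeps `e^{−P}` inside the windowed expectations, so by
value κ-ne7bref-g68-6 stands on the window (`≈ e^{Var_{ν_{W,K}} P}`, unaffordable for a region-extensive remainder — PRICING-NE7b v83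
F440 ∕ v85).  The refuter's σ-ne7bref-g71-1: «the consumer-grade windowed centring is the INTERPOLATED port (TMSI on ν_{W+tP,K}), room
10^{82}∕10^{55}; needs W + tP λ-convex on K ∀ t, automatic when W and W + P are» — WANTED (v85: «port OPTIONAL» withdrawn).  THIS FILE
is that port: the telescoping of `…TiltedMeanShiftInterpolated` run on `ν_{·,K} = (volume.restrict K).tilted(−·)` with the OWNER's
windowed one-step theorem as the step (`abs_windowTiltedMean_step_le`), the by-value step suppliers of `…TiltedMeanShiftInterpolated`
(stated there for ANY finite ∕ probability measure, so they serve the window verbatim), the limit `N → ∞`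
(**`abs_windowTiltedMean_shift_le_interpolated`**, `_sqrt`), and the ENDPOINT reduction of `…TiltedMeanShiftEndpoints` on `K`
(`firstOrderOn_interpolate`: letters between points of `K` are affine in the potential; `integrable_windowTilted_interpolate`;
**`abs_windowTiltedMean_shift_le_interpolated_of_endpoints`**: `K` convex measurable of positive volume, `W` differentiable, `P ∈ C¹`
with `|P| ≤ p` and a pointwise `‖∇P‖² ≤ G`, the `λ`-letters of `W` and `W + P` ON `K`, `e^{−W}` integrable on `K`, two moments of
`⟪u,·⟫` under `ν_{W,K}` ⊢ `|m_{W+P,K} − m_{W,K}| ≤ λ⁻¹·((a₀∕2)‖u‖² + G∕(2a₀))`).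

WHAT IS PROVED ([folklore]; the OWNER's `abs_windowTiltedMean_shift_le`, Mathlib `tilted_tilted` ∕ `integrable_tilted_iff`, and the
parent files' lemmas by name): `windowTilted_interpolate_succ`, `abs_windowTiltedMean_step_le`, **`abs_windowTiltedMean_shift_le_telescoped`**,
**`abs_windowTiltedMean_shift_le_interpolated`**, `abs_windowTiltedMean_shift_le_interpolated_sqrt`, `integrableOn_exp_neg_interpolate`,
`integrable_windowTilted_interpolate`, `firstOrderOn_interpolate`, **`abs_windowTiltedMean_shift_le_interpolated_of_endpoints`**.

NOT HERE (honest): the window `K`, the modulus `λ` on `K` by value (Q-ne7bref-g68-1 ∕ Δ4-num), the size of `G` and that it is REGION-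
not volume-extensive, the letters for Bałaban's anharmonic remainder ((R2′) family (2) readings); anything of Bałaban's.  BY-NAME EFFECT
ON THE WALL: NONE.  NE7b NOT PRINTED ∕ NOT PROVED; spine PROVED 0∕9; rung (B)+1 on a FINITE torus — NOT infinite volume, NOT the mass
gap, NOT Clay.
HONEST DEPENDENCY: continuum YM on T⁴ ⇐ BetaPertH ∧ nine spine estimates (0/9 proved); BetaPertH ⇐ (D1) ∧ (D4) ∧ CAP+tail;
G-an2-4 gates asym, D1 and NE2/3/4.
-/

set_option autoImplicit false

noncomputable section

open MeasureTheory Real Finset Filter Topology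
open scoped RealInnerProductSpace
open Summit.QuantumFields.BalabanUV.T4Continuum.NE7b.TiltedMeanShiftInterpolated
open Summit.QuantumFields.BalabanUV.T4Continuum.NE7b.ConvexWindowTiltedMeanShift

namespace Summit.QuantumFields.BalabanUV.T4Continuum.NE7b.ConvexWindowTiltedMeanShiftInterpolated

section Euclidean

variable {n : ℕ}

/-! ## §1 One step on the window -/

/-- **THE MEASURE IDENTITY ALONG THE INTERPOLATION, ON THE WINDOW**: `ν_{W+(t+s)P,K} = ν_{W+tP,K}.tilted(−sP)`. [folklore] -/
theorem windowTilted_interpolate_succ {W P : EuclideanSpace ℝ (Fin n) → ℝ} {K : Set (EuclideanSpace ℝ (Fin n))} {t s : ℝ}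
    (hZ : IntegrableOn (fun x => exp (-(W x + t * P x))) K) :
    (volume.restrict K).tilted (fun x => -(W x + (t + s) * P x)) =
      ((volume.restrict K).tilted fun x => -(W x + t * P x)).tilted fun x => -(s * P x) := by
  rw [tilted_tilted hZ]
  congr 1
  funext x
  simp only [Pi.add_apply]
  ring

/-- **ONE STEP ON THE WINDOW** (the OWNER's `abs_windowTiltedMean_shift_le` at the reference `W + tP` with the perturbation `sP`).
[folklore] -/
theorem abs_windowTiltedMean_step_le {W P : EuclideanSpace ℝ (Fin n) → ℝ} {lam a t s : ℝ} {K : Set (EuclideanSpace ℝ (Fin n))}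
    (hlam : 0 < lam) (ha : 0 < a) (hK : Convex ℝ K) (hKm : MeasurableSet K) (hK0 : volume K ≠ 0)
    (hVc : Continuous fun x => W x + t * P x)
    (hV : ∀ x ∈ K, ∀ y ∈ K,
      (W x + t * P x) + ⟪gradient (fun z => W z + t * P z) x, y - x⟫ + lam / 2 * ‖y - x‖ ^ 2 ≤ W y + t * P y)
    (hZ : IntegrableOn (fun x => exp (-(W x + t * P x))) K) (hP : ContDiff ℝ 1 P) (u : EuclideanSpace ℝ (Fin n))
    (h1 : Integrable (fun x => ⟪u, x⟫) ((volume.restrict K).tilted fun x => -(W x + t * P x)))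
    (h2 : Integrable (fun x => ⟪u, x⟫ ^ 2) ((volume.restrict K).tilted fun x => -(W x + t * P x)))
    (g1 : Integrable (fun x => exp (-(s * P x))) ((volume.restrict K).tilted fun x => -(W x + t * P x)))
    (g2 : Integrable (fun x => exp (-(s * P x)) ^ 2) ((volume.restrict K).tilted fun x => -(W x + t * P x)))
    (g3 : Integrable (fun x => ‖fderiv ℝ (fun y => exp (-(s * P y))) x‖ ^ 2)
      ((volume.restrict K).tilted fun x => -(W x + t * P x)))
    (hfg : Integrable (fun x => ⟪u, x⟫ * exp (-(s * P x))) ((volume.restrict K).tilted fun x => -(W x + t * P x))) :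
    |∫ x, ⟪u, x⟫ ∂((volume.restrict K).tilted fun x => -(W x + (t + s) * P x)) -
        ∫ x, ⟪u, x⟫ ∂((volume.restrict K).tilted fun x => -(W x + t * P x))| ≤
      lam⁻¹ * (a / 2 * ‖u‖ ^ 2 +
          (∫ x, ‖fderiv ℝ (fun y => exp (-(s * P y))) x‖ ^ 2 ∂((volume.restrict K).tilted fun x => -(W x + t * P x))) /
            (2 * a)) /
        ∫ x, exp (-(s * P x)) ∂((volume.restrict K).tilted fun x => -(W x + t * P x)) := by
  rw [windowTilted_interpolate_succ hZ]
  exact abs_windowTiltedMean_shift_le (W := fun x => W x + t * P x) (P := fun x => s * P x) hlam ha hK hKm hK0 hVc hV hZ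
    (contDiff_const.mul hP) u h1 h2 g1 g2 g3 hfg

/-! ## §2 The telescoped bound on the window and the interpolated windowed port -/

/-- **THE TELESCOPED WINDOWED TILTED-MEAN SHIFT (finite `N`)** — file 3's theorem on the convex window `K`
(`ν_t = ν_{W+tP,K} = (volume.restrict K).tilted(−(W+tP))`).  `W` continuous, `P ∈ C¹` with `|P| ≤ p`; for every `t ∈ [0,1]` the
interpolant `W + tP` is `λ`-uniformly convex (first-order letter), `e^{−(W+tP)}` is integrable, and under `ν_t = (volume.restrict K).tilted(−(W+tP))`
the test function `⟪u,·⟫` has two moments and `‖∇P‖²` is integrable with `∫‖∇P‖² dν_t ≤ G`.  Then for every `N ≥ 1` and `a₀ > 0`: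
`|𝔼_{W+P}⟪u,x⟫ − 𝔼_W⟪u,x⟫| ≤ e^{3p∕N}·λ⁻¹·((a₀∕2)‖u‖² + G∕(2a₀))`. [folklore] -/
theorem abs_windowTiltedMean_shift_le_telescoped {W P : EuclideanSpace ℝ (Fin n) → ℝ} {lam a₀ p G : ℝ}
    {K : Set (EuclideanSpace ℝ (Fin n))} (hlam : 0 < lam) (ha₀ : 0 < a₀) (hK : Convex ℝ K) (hKm : MeasurableSet K)
    (hK0 : volume K ≠ 0) (hWc : Continuous W) (hP : ContDiff ℝ 1 P) (hp : ∀ x, |P x| ≤ p)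
    (hV : ∀ t ∈ Set.Icc (0 : ℝ) 1, ∀ x ∈ K, ∀ y ∈ K,
      (W x + t * P x) + ⟪gradient (fun z => W z + t * P z) x, y - x⟫ + lam / 2 * ‖y - x‖ ^ 2 ≤ W y + t * P y)
    (hZ : ∀ t ∈ Set.Icc (0 : ℝ) 1, IntegrableOn (fun x => exp (-(W x + t * P x))) K) (u : EuclideanSpace ℝ (Fin n))
    (h1 : ∀ t ∈ Set.Icc (0 : ℝ) 1, Integrable (fun x => ⟪u, x⟫) ((volume.restrict K).tilted fun x => -(W x + t * P x)))
    (h2 : ∀ t ∈ Set.Icc (0 : ℝ) 1, Integrable (fun x => ⟪u, x⟫ ^ 2) ((volume.restrict K).tilted fun x => -(W x + t * P x)))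
    (hgrad : ∀ t ∈ Set.Icc (0 : ℝ) 1, Integrable (fun x => ‖fderiv ℝ P x‖ ^ 2) ((volume.restrict K).tilted fun x => -(W x + t * P x)))
    (hG : ∀ t ∈ Set.Icc (0 : ℝ) 1, ∫ x, ‖fderiv ℝ P x‖ ^ 2 ∂((volume.restrict K).tilted fun x => -(W x + t * P x)) ≤ G)
    {N : ℕ} (hN : 0 < N) :
    |∫ x, ⟪u, x⟫ ∂((volume.restrict K).tilted fun x => -(W x + P x)) - ∫ x, ⟪u, x⟫ ∂((volume.restrict K).tilted fun x => -W x)| ≤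
      exp (3 * p / N) * (lam⁻¹ * (a₀ / 2 * ‖u‖ ^ 2 + G / (2 * a₀))) := by
  have hNr : (0 : ℝ) < N := Nat.cast_pos.mpr hN
  have hp0 : 0 ≤ p := (abs_nonneg _).trans (hp 0)
  have hPc : Continuous P := hP.continuous
  -- the interpolating means
  set m : ℕ → ℝ := fun k => ∫ x, ⟪u, x⟫ ∂((volume.restrict K).tilted fun x => -(W x + (k : ℝ) / N * P x)) with hm
  -- the step size and the per-step constant bound
  set s : ℝ := 1 / N with hs
  have hs0 : 0 < s := by rw [hs]; positivity
  have hsabs : |s| = s := abs_of_pos hs0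
  set a : ℝ := a₀ / N with hadef
  have ha : 0 < a := by rw [hadef]; positivity
  set B : ℝ := exp (s * p) * (lam⁻¹ * (a / 2 * ‖u‖ ^ 2 + exp (s * p) ^ 2 * (s ^ 2 * G) / (2 * a))) with hB
  -- each step is bounded by `B`
  have step : ∀ k, k < N → |m (k + 1) - m k| ≤ B := by
    intro k hk
    have htk : ((k : ℝ) / N) ∈ Set.Icc (0 : ℝ) 1 :=
      ⟨by positivity, (div_le_one hNr).mpr (by exact_mod_cast hk.le)⟩
    haveI : NeZero (volume.restrict K : Measure (EuclideanSpace ℝ (Fin n))) :=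
      ⟨fun h => hK0 (Measure.restrict_eq_zero.1 h)⟩
    haveI : IsProbabilityMeasure ((volume.restrict K).tilted fun x : EuclideanSpace ℝ (Fin n) => -(W x + (k : ℝ) / N * P x)) :=
      isProbabilityMeasure_tilted (hZ _ htk)
    have hVc : Continuous fun x => W x + (k : ℝ) / N * P x := hWc.add (continuous_const.mul hPc)
    have e_succ : ((k + 1 : ℕ) : ℝ) / N = (k : ℝ) / N + s := by rw [hs]; push_cast; ring
    have key := abs_windowTiltedMean_step_le (t := (k : ℝ) / N) (s := s) hlam ha hK hKm hK0 hVc (hV _ htk) (hZ _ htk) hP u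
      (h1 _ htk) (h2 _ htk)
      (integrable_exp_neg_smul hPc hp s) (integrable_exp_neg_smul_sq hPc hp s)
      (integrable_norm_fderiv_exp_neg_smul_sq hP hp s (hgrad _ htk)) (integrable_inner_mul_exp_neg_smul hPc hp s u (h1 _ htk))
    have hm1 : m (k + 1) = ∫ x, ⟪u, x⟫ ∂((volume.restrict K).tilted fun x => -(W x + ((k : ℝ) / N + s) * P x)) := by
      simp only [hm, e_succ]
    rw [hm1]
    refine key.trans ?_
    -- numerator and denominator by value
    have hD : exp (-(s * p)) ≤ ∫ x, exp (-(s * P x)) ∂((volume.restrict K).tilted fun x => -(W x + (k : ℝ) / N * P x)) := by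
      have := integral_exp_neg_smul_ge (μ := (volume.restrict K).tilted fun x => -(W x + (k : ℝ) / N * P x)) hPc hp s
      rwa [hsabs] at this
    have hI : ∫ x, ‖fderiv ℝ (fun y => exp (-(s * P y))) x‖ ^ 2 ∂((volume.restrict K).tilted fun x => -(W x + (k : ℝ) / N * P x)) ≤
        exp (s * p) ^ 2 * (s ^ 2 * G) := by
      have := integral_norm_fderiv_exp_neg_smul_sq_le (μ := (volume.restrict K).tilted fun x => -(W x + (k : ℝ) / N * P x)) hP hp s (hgrad _ htk)
      rw [hsabs] at this
      exact this.trans (mul_le_mul_of_nonneg_left (mul_le_mul_of_nonneg_left (hG _ htk) (sq_nonneg _)) (sq_nonneg _))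
    have hnum_nonneg : 0 ≤ lam⁻¹ * (a / 2 * ‖u‖ ^ 2 + exp (s * p) ^ 2 * (s ^ 2 * G) / (2 * a)) := by
      have hG0 : 0 ≤ G := (integral_nonneg fun x => sq_nonneg _).trans (hG _ htk)
      positivity
    calc lam⁻¹ * (a / 2 * ‖u‖ ^ 2 +
            (∫ x, ‖fderiv ℝ (fun y => exp (-(s * P y))) x‖ ^ 2 ∂((volume.restrict K).tilted fun x => -(W x + (k : ℝ) / N * P x))) / (2 * a)) /
          ∫ x, exp (-(s * P x)) ∂((volume.restrict K).tilted fun x => -(W x + (k : ℝ) / N * P x))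
        ≤ lam⁻¹ * (a / 2 * ‖u‖ ^ 2 + exp (s * p) ^ 2 * (s ^ 2 * G) / (2 * a)) /
            ∫ x, exp (-(s * P x)) ∂((volume.restrict K).tilted fun x => -(W x + (k : ℝ) / N * P x)) :=
          div_le_div_of_nonneg_right
            (mul_le_mul_of_nonneg_left
              (add_le_add le_rfl (div_le_div_of_nonneg_right hI (by positivity : (0 : ℝ) ≤ 2 * a)))
              (inv_pos.mpr hlam).le)
            ((exp_pos _).le.trans hD)
      _ ≤ lam⁻¹ * (a / 2 * ‖u‖ ^ 2 + exp (s * p) ^ 2 * (s ^ 2 * G) / (2 * a)) / exp (-(s * p)) :=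
          div_le_div_of_nonneg_left hnum_nonneg (exp_pos _) hD
      _ = B := by rw [hB, exp_neg, div_inv_eq_mul, mul_comm]
  -- telescope
  have tel := abs_sub_le_sum_of_steps m (fun _ => B) N step
  have e0 : m 0 = ∫ x, ⟪u, x⟫ ∂((volume.restrict K).tilted fun x => -W x) := by
    simp only [hm, Nat.cast_zero, zero_div, zero_mul, add_zero]
  have eN : m N = ∫ x, ⟪u, x⟫ ∂((volume.restrict K).tilted fun x => -(W x + P x)) := by
    simp only [hm, div_self hNr.ne', one_mul]
  rw [← eN, ← e0]
  refine tel.trans ?_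
  rw [sum_const, card_range, nsmul_eq_mul]
  -- the arithmetic: `N·B = e^{p∕N}·λ⁻¹·((a₀∕2)‖u‖² + e^{2p∕N}·G∕(2a₀)) ≤ e^{3p∕N}·λ⁻¹·((a₀∕2)‖u‖² + G∕(2a₀))`
  have hG0 : 0 ≤ G := (integral_nonneg fun x => sq_nonneg _).trans (hG 0 ⟨le_rfl, zero_le_one⟩)
  have e1 : (N : ℝ) * B = exp (s * p) * (lam⁻¹ * (a₀ / 2 * ‖u‖ ^ 2 + exp (s * p) ^ 2 * G / (2 * a₀))) := by
    rw [hB, hadef, hs]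
    field_simp
  rw [e1]
  have e3 : exp (3 * p / N) = exp (s * p) * exp (s * p) ^ 2 := by
    rw [sq, ← exp_add, ← exp_add]; congr 1; rw [hs]; ring
  rw [e3, mul_assoc]
  refine mul_le_mul_of_nonneg_left ?_ (exp_pos _).le
  have hsq1 : 1 ≤ exp (s * p) ^ 2 := one_le_pow₀ (one_le_exp (by positivity))
  rw [← mul_assoc, mul_comm (exp (s * p) ^ 2) lam⁻¹, mul_assoc]
  refine mul_le_mul_of_nonneg_left ?_ (inv_pos.mpr hlam).le
  rw [mul_add]
  refine add_le_add ?_ (le_of_eq ?_)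
  · exact le_mul_of_one_le_left (by positivity) hsq1
  · ring

/-- **THE INTERPOLATED WINDOWED PORT (the refuter's σ-ne7bref-g71-1): the interpolation END on a convex window, DERIVATIVE-FREE.**
Under the hypotheses of `abs_windowTiltedMean_shift_le_telescoped` (uniform convexity of `W + tP` and `∫‖∇P‖² dν_{W+tP} ≤ G` along `t ∈ [0,1]`,
`|P| ≤ p` for SOME `p` — which does not enter the bound), for every `a₀ > 0`:
`|𝔼_{W+P}⟪u,x⟫ − 𝔼_W⟪u,x⟫| ≤ λ⁻¹·((a₀∕2)‖u‖² + G∕(2a₀))` — NO `e^{∫P}`, NO `sup|P|`: the letter `N → ∞` of the telescoped bound.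
[folklore] -/
theorem abs_windowTiltedMean_shift_le_interpolated {W P : EuclideanSpace ℝ (Fin n) → ℝ} {lam a₀ p G : ℝ}
    {K : Set (EuclideanSpace ℝ (Fin n))} (hlam : 0 < lam) (ha₀ : 0 < a₀) (hK : Convex ℝ K) (hKm : MeasurableSet K)
    (hK0 : volume K ≠ 0) (hWc : Continuous W) (hP : ContDiff ℝ 1 P) (hp : ∀ x, |P x| ≤ p)
    (hV : ∀ t ∈ Set.Icc (0 : ℝ) 1, ∀ x ∈ K, ∀ y ∈ K,
      (W x + t * P x) + ⟪gradient (fun z => W z + t * P z) x, y - x⟫ + lam / 2 * ‖y - x‖ ^ 2 ≤ W y + t * P y)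
    (hZ : ∀ t ∈ Set.Icc (0 : ℝ) 1, IntegrableOn (fun x => exp (-(W x + t * P x))) K) (u : EuclideanSpace ℝ (Fin n))
    (h1 : ∀ t ∈ Set.Icc (0 : ℝ) 1, Integrable (fun x => ⟪u, x⟫) ((volume.restrict K).tilted fun x => -(W x + t * P x)))
    (h2 : ∀ t ∈ Set.Icc (0 : ℝ) 1, Integrable (fun x => ⟪u, x⟫ ^ 2) ((volume.restrict K).tilted fun x => -(W x + t * P x)))
    (hgrad : ∀ t ∈ Set.Icc (0 : ℝ) 1, Integrable (fun x => ‖fderiv ℝ P x‖ ^ 2) ((volume.restrict K).tilted fun x => -(W x + t * P x)))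
    (hG : ∀ t ∈ Set.Icc (0 : ℝ) 1, ∫ x, ‖fderiv ℝ P x‖ ^ 2 ∂((volume.restrict K).tilted fun x => -(W x + t * P x)) ≤ G) :
    |∫ x, ⟪u, x⟫ ∂((volume.restrict K).tilted fun x => -(W x + P x)) - ∫ x, ⟪u, x⟫ ∂((volume.restrict K).tilted fun x => -W x)| ≤
      lam⁻¹ * (a₀ / 2 * ‖u‖ ^ 2 + G / (2 * a₀)) := by
  set C := lam⁻¹ * (a₀ / 2 * ‖u‖ ^ 2 + G / (2 * a₀)) with hC
  -- `e^{3p∕N}·C → C`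
  have hlim : Tendsto (fun N : ℕ => exp (3 * p / (N : ℝ)) * C) atTop (𝓝 C) := by
    have h3 : Tendsto (fun N : ℕ => 3 * p / (N : ℝ)) atTop (𝓝 0) := tendsto_const_div_atTop_nhds_zero_nat (3 * p)
    have h4 := ((continuous_exp.tendsto 0).comp h3).mul_const C
    rwa [exp_zero, one_mul] at h4
  refine ge_of_tendsto hlim (Filter.eventually_atTop.2 ⟨1, fun N hN => ?_⟩)
  exact abs_windowTiltedMean_shift_le_telescoped hlam ha₀ hK hKm hK0 hWc hP hp hV hZ u h1 h2 hgrad hG hN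

/-- The same with `a₀` optimised: `|𝔼_{W+P}⟪u,x⟫ − 𝔼_W⟪u,x⟫| ≤ λ⁻¹·‖u‖·√G` (for `u ≠ 0`, `G > 0`; take `a₀ = √G∕‖u‖`). [folklore] -/
theorem abs_windowTiltedMean_shift_le_interpolated_sqrt {W P : EuclideanSpace ℝ (Fin n) → ℝ} {lam p G : ℝ}
    {K : Set (EuclideanSpace ℝ (Fin n))} (hlam : 0 < lam) (hK : Convex ℝ K) (hKm : MeasurableSet K) (hK0 : volume K ≠ 0)
    (hWc : Continuous W) (hP : ContDiff ℝ 1 P) (hp : ∀ x, |P x| ≤ p)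
    (hV : ∀ t ∈ Set.Icc (0 : ℝ) 1, ∀ x ∈ K, ∀ y ∈ K,
      (W x + t * P x) + ⟪gradient (fun z => W z + t * P z) x, y - x⟫ + lam / 2 * ‖y - x‖ ^ 2 ≤ W y + t * P y)
    (hZ : ∀ t ∈ Set.Icc (0 : ℝ) 1, IntegrableOn (fun x => exp (-(W x + t * P x))) K) {u : EuclideanSpace ℝ (Fin n)} (hu : u ≠ 0)
    (h1 : ∀ t ∈ Set.Icc (0 : ℝ) 1, Integrable (fun x => ⟪u, x⟫) ((volume.restrict K).tilted fun x => -(W x + t * P x)))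
    (h2 : ∀ t ∈ Set.Icc (0 : ℝ) 1, Integrable (fun x => ⟪u, x⟫ ^ 2) ((volume.restrict K).tilted fun x => -(W x + t * P x)))
    (hgrad : ∀ t ∈ Set.Icc (0 : ℝ) 1, Integrable (fun x => ‖fderiv ℝ P x‖ ^ 2) ((volume.restrict K).tilted fun x => -(W x + t * P x)))
    (hGpos : 0 < G)
    (hG : ∀ t ∈ Set.Icc (0 : ℝ) 1, ∫ x, ‖fderiv ℝ P x‖ ^ 2 ∂((volume.restrict K).tilted fun x => -(W x + t * P x)) ≤ G) :
    |∫ x, ⟪u, x⟫ ∂((volume.restrict K).tilted fun x => -(W x + P x)) - ∫ x, ⟪u, x⟫ ∂((volume.restrict K).tilted fun x => -W x)| ≤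
      lam⁻¹ * (‖u‖ * Real.sqrt G) := by
  have hu' : 0 < ‖u‖ := norm_pos_iff.mpr hu
  have hsG : 0 < Real.sqrt G := Real.sqrt_pos.mpr hGpos
  have key := abs_windowTiltedMean_shift_le_interpolated (a₀ := Real.sqrt G / ‖u‖) hlam (by positivity) hK hKm hK0 hWc hP hp hV
    hZ u h1 h2 hgrad hG
  refine key.trans (le_of_eq ?_)
  congr 1
  have hGe : G = Real.sqrt G * Real.sqrt G := (Real.mul_self_sqrt hGpos.le).symm
  field_simp
  nlinarith [hGe, hu', hsG]


/-! ## §3 The windowed END from ENDPOINT letters on `K` -/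

/-- `e^{−(W+tP)}` is integrable ON `K` for `t ∈ [0,1]` when `e^{−W}` is and `|P| ≤ p` (`W`, `P` continuous). [folklore] -/
theorem integrableOn_exp_neg_interpolate {W P : EuclideanSpace ℝ (Fin n) → ℝ} {K : Set (EuclideanSpace ℝ (Fin n))} {p t : ℝ}
    (hWc : Continuous W) (hPc : Continuous P)
    (hp : ∀ x, |P x| ≤ p) (ht : t ∈ Set.Icc (0 : ℝ) 1) (hZ : IntegrableOn (fun x => exp (-W x)) K) :
    IntegrableOn (fun x => exp (-(W x + t * P x))) K := by
  refine (hZ.const_mul (exp p)).mono' (by fun_prop : Continuous fun x => exp (-(W x + t * P x))).aestronglyMeasurable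
    (ae_of_all _ fun x => ?_)
  rw [Real.norm_eq_abs, abs_of_pos (exp_pos _), ← exp_add]
  refine exp_le_exp.mpr ?_
  have h1 : -(t * P x) ≤ |t * P x| := neg_le_abs _
  have h2 : |t * P x| = |t| * |P x| := abs_mul _ _
  have h3 : |t| ≤ 1 := by rw [abs_of_nonneg ht.1]; exact ht.2
  have h4 : |t| * |P x| ≤ 1 * p := mul_le_mul h3 (hp x) (abs_nonneg _) zero_le_one
  linarith

/-- **INTEGRABILITY TRANSFERS ALONG THE INTERPOLATION, ON THE WINDOW**: a real function integrable under `ν_{W,K}` is integrable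
under `ν_{W+tP,K}` for
`t ∈ [0,1]` when `|P| ≤ p` (`integrable_tilted_iff`: the densities differ by the bounded factor `e^{−tP}`). [folklore] -/
theorem integrable_windowTilted_interpolate {W P : EuclideanSpace ℝ (Fin n) → ℝ} {K : Set (EuclideanSpace ℝ (Fin n))} {p t : ℝ}
    (hWc : Continuous W) (hPc : Continuous P)
    (hp : ∀ x, |P x| ≤ p) (ht : t ∈ Set.Icc (0 : ℝ) 1) (hZ : IntegrableOn (fun x => exp (-W x)) K)
    {f : EuclideanSpace ℝ (Fin n) → ℝ} (hfm : AEStronglyMeasurable f (volume.restrict K))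
    (hf : Integrable f ((volume.restrict K).tilted fun x => -W x)) :
    Integrable f ((volume.restrict K).tilted fun x => -(W x + t * P x)) := by
  have hZt := integrableOn_exp_neg_interpolate hWc hPc hp ht hZ
  rw [integrable_tilted_iff hZt]
  have hf' : Integrable (fun x => exp (-W x) • f x) (volume.restrict K) := (integrable_tilted_iff hZ f).mp hf
  refine (hf'.norm.const_mul (exp p)).mono' ((by fun_prop : Continuous fun x => exp (-(W x + t * P x))).aestronglyMeasurable.smul hfm)
    (ae_of_all _ fun x => ?_)
  simp only [norm_smul, Real.norm_eq_abs, Real.abs_exp]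
  rw [← mul_assoc, ← exp_add]
  refine mul_le_mul_of_nonneg_right (exp_le_exp.mpr ?_) (abs_nonneg _)
  have h1 : -(t * P x) ≤ |t * P x| := neg_le_abs _
  have h2 : |t * P x| = |t| * |P x| := abs_mul _ _
  have h3 : |t| ≤ 1 := by rw [abs_of_nonneg ht.1]; exact ht.2
  have h4 : |t| * |P x| ≤ 1 * p := mul_le_mul h3 (hp x) (abs_nonneg _) zero_le_one
  linarith

/-- **FIRST-ORDER CONVEXITY LETTERS ON `K` ARE AFFINE IN THE POTENTIAL**: the `λ`-letters of `W` and of `W + P` between points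
of `K` give the `λ`-letter of `W + tP` on `K` for every `t ∈ [0,1]` (`W`, `P` differentiable; `⟪∇f x, v⟫ = Df(x)v`). [folklore] -/
theorem firstOrderOn_interpolate {W P : EuclideanSpace ℝ (Fin n) → ℝ} {lam t : ℝ} (hW : Differentiable ℝ W) (hP : Differentiable ℝ P)
    {K : Set (EuclideanSpace ℝ (Fin n))}
    (hV0 : ∀ x ∈ K, ∀ y ∈ K, W x + ⟪gradient W x, y - x⟫ + lam / 2 * ‖y - x‖ ^ 2 ≤ W y)
    (hV1 : ∀ x ∈ K, ∀ y ∈ K, (W x + P x) + ⟪gradient (fun z => W z + P z) x, y - x⟫ + lam / 2 * ‖y - x‖ ^ 2 ≤ W y + P y)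
    (ht : t ∈ Set.Icc (0 : ℝ) 1) {x y : EuclideanSpace ℝ (Fin n)} (hx : x ∈ K) (hy : y ∈ K) :
    (W x + t * P x) + ⟪gradient (fun z => W z + t * P z) x, y - x⟫ + lam / 2 * ‖y - x‖ ^ 2 ≤ W y + t * P y := by
  have hWx := hW x
  have hPx := hP x
  have e0 : ⟪gradient W x, y - x⟫ = fderiv ℝ W x (y - x) := inner_gradient_left
  have e1 : ⟪gradient (fun z => W z + P z) x, y - x⟫ = fderiv ℝ W x (y - x) + fderiv ℝ P x (y - x) := by
    rw [inner_gradient_left, fderiv_fun_add hWx hPx, _root_.add_apply]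
  have et : ⟪gradient (fun z => W z + t * P z) x, y - x⟫ = fderiv ℝ W x (y - x) + t * fderiv ℝ P x (y - x) := by
    rw [inner_gradient_left, fderiv_fun_add hWx (hPx.const_mul t), fderiv_const_mul hPx t, _root_.add_apply,
      _root_.smul_apply, smul_eq_mul]
  have a0 := hV0 x hx y hy
  have a1 := hV1 x hx y hy
  rw [e0] at a0
  rw [e1] at a1
  rw [et]
  have ht0 : 0 ≤ t := ht.1
  have ht1 : 0 ≤ 1 - t := sub_nonneg.mpr ht.2
  nlinarith [mul_le_mul_of_nonneg_left a0 ht1, mul_le_mul_of_nonneg_left a1 ht0]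

/-- **THE WINDOWED INTERPOLATION END FROM ENDPOINT DATA ONLY** (`K` convex measurable of positive volume).  `W` differentiable, `P ∈ C¹` with `|P| ≤ p` and a POINTWISE `‖∇P‖² ≤ G`;
the `λ`-uniform first-order convexity letters of `W` and of `W + P` (take `λ = min(λ₀, λ₁)`); `e^{−W}` integrable and `⟪u,·⟫` with two
moments under `ν_W`.  Then `|𝔼_{W+P}⟪u,x⟫ − 𝔼_W⟪u,x⟫| ≤ λ⁻¹·((a₀∕2)‖u‖² + G∕(2a₀))` for every `a₀ > 0` — all the `t ∈ [0,1]`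
hypotheses of `abs_windowTiltedMean_shift_le_interpolated` are DERIVED (`firstOrderOn_interpolate`, `integrableOn_exp_neg_interpolate`,
`integrable_windowTilted_interpolate`). [folklore] -/
theorem abs_windowTiltedMean_shift_le_interpolated_of_endpoints {W P : EuclideanSpace ℝ (Fin n) → ℝ} {lam a₀ p G : ℝ}
    {K : Set (EuclideanSpace ℝ (Fin n))} (hlam : 0 < lam) (ha₀ : 0 < a₀) (hK : Convex ℝ K) (hKm : MeasurableSet K)
    (hK0 : volume K ≠ 0) (hW : Differentiable ℝ W) (hP : ContDiff ℝ 1 P) (hp : ∀ x, |P x| ≤ p)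
    (hV0 : ∀ x ∈ K, ∀ y ∈ K, W x + ⟪gradient W x, y - x⟫ + lam / 2 * ‖y - x‖ ^ 2 ≤ W y)
    (hV1 : ∀ x ∈ K, ∀ y ∈ K, (W x + P x) + ⟪gradient (fun z => W z + P z) x, y - x⟫ + lam / 2 * ‖y - x‖ ^ 2 ≤ W y + P y)
    (hZ : IntegrableOn (fun x => exp (-W x)) K) (u : EuclideanSpace ℝ (Fin n))
    (h1 : Integrable (fun x => ⟪u, x⟫) ((volume.restrict K).tilted fun x => -W x))
    (h2 : Integrable (fun x => ⟪u, x⟫ ^ 2) ((volume.restrict K).tilted fun x => -W x))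
    (hG : ∀ x, ‖fderiv ℝ P x‖ ^ 2 ≤ G) :
    |∫ x, ⟪u, x⟫ ∂((volume.restrict K).tilted fun x => -(W x + P x)) - ∫ x, ⟪u, x⟫ ∂((volume.restrict K).tilted fun x => -W x)| ≤
      lam⁻¹ * (a₀ / 2 * ‖u‖ ^ 2 + G / (2 * a₀)) := by
  have hWc : Continuous W := hW.continuous
  have hPc : Continuous P := hP.continuous
  have hPd : Differentiable ℝ P := hP.differentiable one_ne_zero
  have hgc : Continuous fun x => ‖fderiv ℝ P x‖ ^ 2 := (hP.continuous_fderiv one_ne_zero).norm.pow 2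
  have hic : Continuous fun x : EuclideanSpace ℝ (Fin n) => ⟪u, x⟫ := by fun_prop
  have hZt : ∀ t ∈ Set.Icc (0 : ℝ) 1, IntegrableOn (fun x => exp (-(W x + t * P x))) K :=
    fun t ht => integrableOn_exp_neg_interpolate hWc hPc hp ht hZ
  haveI : NeZero (volume.restrict K : Measure (EuclideanSpace ℝ (Fin n))) := ⟨fun h => hK0 (Measure.restrict_eq_zero.1 h)⟩
  have hprob : ∀ t ∈ Set.Icc (0 : ℝ) 1,
      IsProbabilityMeasure ((volume.restrict K).tilted fun x : EuclideanSpace ℝ (Fin n) => -(W x + t * P x)) :=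
    fun t ht => isProbabilityMeasure_tilted (hZt t ht)
  refine abs_windowTiltedMean_shift_le_interpolated hlam ha₀ hK hKm hK0 hWc hP hp
    (fun t ht x hx y hy => firstOrderOn_interpolate hW hPd hV0 hV1 ht hx hy)
    hZt u (fun t ht => integrable_windowTilted_interpolate hWc hPc hp ht hZ hic.aestronglyMeasurable (h1))
    (fun t ht => integrable_windowTilted_interpolate hWc hPc hp ht hZ (hic.pow 2).aestronglyMeasurable h2)
    (fun t ht => ?_) (fun t ht => ?_)
  · haveI := hprob t ht
    exact integrable_of_continuous_of_abs_le hgc fun x => by rw [abs_of_nonneg (sq_nonneg _)]; exact hG x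
  · haveI := hprob t ht
    have h := integral_mono (μ := (volume.restrict K).tilted fun x : EuclideanSpace ℝ (Fin n) => -(W x + t * P x))
      (integrable_of_continuous_of_abs_le hgc fun x => by rw [abs_of_nonneg (sq_nonneg _)]; exact hG x)
      (integrable_const G) hG
    rwa [integral_const, smul_eq_mul, probReal_univ, one_mul] at h

end Euclidean

end Summit.QuantumFields.BalabanUV.T4Continuum.NE7b.ConvexWindowTiltedMeanShiftInterpolated
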